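import Mathlib
import Summits.ValiantsHypothesis.ValiantsHypothesis.Theorems.LacunarySymmetroidMatrixDescartesProductPlusOneLensCloudSymmetric

/-!
# Product-plus-one line — CLOUD CORE in lens currency, VI: the phase ACCELERATION at a zero of the phase velocity
# (multiplier-free, pointwise DOWN-CROSSING LAW)

Helper file for `stmt-ValiantsHypothesis-18050` (`MatrixDescartes`), line `product_plus_one`, floor
`stub_oneChangeFloorK3`, open core (CL-F1) (clouds).  Sequel of `…LensCloudSymmetric` (p827382); same dictionary
(p3 g20 NOTE §8): cloud `(κ, p, r)`, phase `y = κ + p e^{-au} + r e^{bu}`, velocity `y'`, company phase velocity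
`Θ' = Σ_i y_i'/(1+y_i²) = -F₁`; COMPATIBILITY numerator `N_i = ab(κ - y_i)(1+y_i²) + 2 y_i y_i'²`.  Def-free.
Nothing here closes a stub; VP ≠ VNP is not touched.

## What is proved
* `hasDerivAt_phaseVelocity` : the phase ACCELERATION, `Θ'' = -(a-b)·Θ' - Σ_i N_i/(1+y_i²)²` (from the symmetric
  envelope of `…LensCloudSymmetric`: `Θ' = e^{-(a-b)u}·V`, `V' = -e^{(a-b)u} Σ N_i/(1+y_i²)²`).
* `hasDerivAt_phaseVelocity_at_zero` : AT A ZERO of `Θ'` the multiplier term drops: `Θ''(u₀) = -Σ_i N_i(u₀)/(1+y_i(u₀)²)²`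
  — the sign of the crossing is decided by the compatibility numerators AT THE POINT, no window needed.
* DOWN-CROSSING LAW `phaseAccel_neg_at_zero` : if every row is compatible at the zero `u₀` (`N_i(u₀) ≥ 0`) and one
  strictly, then `Θ''(u₀) < 0`: the zero is a transversal DOWNWARD crossing of `Θ'` (upward of `F₁`).  Reading for
  (CL-1′): between two downward crossings there is an upward one, and an upward crossing of `Θ'` can only sit at a point
  where some cloud is incompatible (out of phase AND steep) — the sign changes of `F₁` in excess of one per window are
  twice the number of such points.
-/

set_option linter.dupNamespace false

open Real Finset BigOperators

namespace Summit.ValiantsHypothesis.ValiantsHypothesis.Theorems.LacunarySymmetroidMatrixDescartes.ProductPlusOne.LensCloudCrossing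

variable {ι : Type*} [Fintype ι]

/-- `e^{-(a-b)u} · e^{(a-b)u} = 1`. [folklore] -/
theorem exp_neg_mul_exp_self (c u : ℝ) : exp (-(c * u)) * exp (c * u) = 1 := by
  rw [← Real.exp_add]; simp

/-- **The phase acceleration**: `Θ'' = -(a-b)Θ' - Σ_i N_i/(1+y_i²)²`. [this file's theorem] -/
theorem hasDerivAt_phaseVelocity (a b κ u : ℝ) (p r : ι → ℝ) :
    HasDerivAt (fun u => ∑ i, (-(a * p i) * exp (-(a * u)) + b * r i * exp (b * u))
        / (1 + (κ + p i * exp (-(a * u)) + r i * exp (b * u)) ^ 2))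
      (-(a - b) * (∑ i, (-(a * p i) * exp (-(a * u)) + b * r i * exp (b * u))
          / (1 + (κ + p i * exp (-(a * u)) + r i * exp (b * u)) ^ 2))
        - ∑ i, ((a * b * (-(p i * exp (-(a * u))) - r i * exp (b * u))
              * (1 + (κ + p i * exp (-(a * u)) + r i * exp (b * u)) ^ 2)
            + 2 * (κ + p i * exp (-(a * u)) + r i * exp (b * u))
              * (-(a * p i) * exp (-(a * u)) + b * r i * exp (b * u)) ^ 2)
          / (1 + (κ + p i * exp (-(a * u)) + r i * exp (b * u)) ^ 2) ^ 2)) u := by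
  -- `Θ' = e^{-(a-b)u} · V`
  have hfun : (fun u => ∑ i, (-(a * p i) * exp (-(a * u)) + b * r i * exp (b * u))
        / (1 + (κ + p i * exp (-(a * u)) + r i * exp (b * u)) ^ 2))
      = fun u => exp (-((a - b) * u)) * ∑ i, exp ((a - b) * u)
          * ((-(a * p i) * exp (-(a * u)) + b * r i * exp (b * u))
            / (1 + (κ + p i * exp (-(a * u)) + r i * exp (b * u)) ^ 2)) := by
    funext v
    rw [LensCloudSymmetric.symVelocity_eq, ← mul_assoc, exp_neg_mul_exp_self, one_mul]
  have hE : HasDerivAt (fun u : ℝ => exp (-((a - b) * u))) (exp (-((a - b) * u)) * (-(a - b))) u := by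
    have h1 : HasDerivAt (fun u : ℝ => -((a - b) * u)) (-(a - b)) u := by
      have h0 : HasDerivAt (fun u : ℝ => (a - b) * u) (a - b) u := by
        simpa using (hasDerivAt_id u).const_mul (a - b)
      exact h0.neg
    exact h1.exp
  have hV := LensCloudSymmetric.hasDerivAt_symVelocity a b κ u p r
  have hprod := hE.mul hV
  rw [hfun]
  refine hprod.congr_deriv ?_
  -- simplify `E'·V + E·V'`
  rw [LensCloudSymmetric.symVelocity_eq, Finset.mul_sum, Finset.mul_sum, Finset.mul_sum, Finset.mul_sum,
    ← Finset.sum_add_distrib, ← Finset.sum_sub_distrib]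
  refine Finset.sum_congr rfl fun i _ => ?_
  have hEE : exp (-((a - b) * u)) * exp ((a - b) * u) = 1 := exp_neg_mul_exp_self (a - b) u
  have key : ∀ X Y Z : ℝ,
      exp (-((a - b) * u)) * -(a - b) * (exp ((a - b) * u) * X)
        + exp (-((a - b) * u)) * -(exp ((a - b) * u) * Y / Z) = -(a - b) * X - Y / Z := by
    intro X Y Z
    have h : exp (-((a - b) * u)) * -(a - b) * (exp ((a - b) * u) * X)
        + exp (-((a - b) * u)) * -(exp ((a - b) * u) * Y / Z)
        = (exp (-((a - b) * u)) * exp ((a - b) * u)) * (-(a - b) * X - Y / Z) := by ring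
    rw [h, hEE, one_mul]
  exact key _ _ _

/-- **The phase acceleration AT A ZERO of the phase velocity**: `Θ'(u₀) = 0 ⇒ Θ''(u₀) = -Σ_i N_i/(1+y_i²)²`.
[this file's theorem] -/
theorem hasDerivAt_phaseVelocity_at_zero (a b κ u : ℝ) (p r : ι → ℝ)
    (h0 : ∑ i, (-(a * p i) * exp (-(a * u)) + b * r i * exp (b * u))
        / (1 + (κ + p i * exp (-(a * u)) + r i * exp (b * u)) ^ 2) = 0) :
    HasDerivAt (fun u => ∑ i, (-(a * p i) * exp (-(a * u)) + b * r i * exp (b * u))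
        / (1 + (κ + p i * exp (-(a * u)) + r i * exp (b * u)) ^ 2))
      (-(∑ i, ((a * b * (-(p i * exp (-(a * u))) - r i * exp (b * u))
              * (1 + (κ + p i * exp (-(a * u)) + r i * exp (b * u)) ^ 2)
            + 2 * (κ + p i * exp (-(a * u)) + r i * exp (b * u))
              * (-(a * p i) * exp (-(a * u)) + b * r i * exp (b * u)) ^ 2)
          / (1 + (κ + p i * exp (-(a * u)) + r i * exp (b * u)) ^ 2) ^ 2))) u := by
  have h := hasDerivAt_phaseVelocity a b κ u p r
  rw [h0, mul_zero, zero_sub] at h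
  exact h

/-- **DOWN-CROSSING LAW**: at a zero of `Θ'` where every row is compatible and one strictly, `Θ'' < 0`.
[this file's theorem] -/
theorem phaseAccel_neg_at_zero (a b κ u : ℝ) (p r : ι → ℝ)
    (hc : ∀ i, 0 ≤ a * b * (-(p i * exp (-(a * u))) - r i * exp (b * u))
              * (1 + (κ + p i * exp (-(a * u)) + r i * exp (b * u)) ^ 2)
            + 2 * (κ + p i * exp (-(a * u)) + r i * exp (b * u))
              * (-(a * p i) * exp (-(a * u)) + b * r i * exp (b * u)) ^ 2)
    (i₀ : ι) (hi₀ : 0 < a * b * (-(p i₀ * exp (-(a * u))) - r i₀ * exp (b * u))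
              * (1 + (κ + p i₀ * exp (-(a * u)) + r i₀ * exp (b * u)) ^ 2)
            + 2 * (κ + p i₀ * exp (-(a * u)) + r i₀ * exp (b * u))
              * (-(a * p i₀) * exp (-(a * u)) + b * r i₀ * exp (b * u)) ^ 2) :
    -(∑ i, ((a * b * (-(p i * exp (-(a * u))) - r i * exp (b * u))
              * (1 + (κ + p i * exp (-(a * u)) + r i * exp (b * u)) ^ 2)
            + 2 * (κ + p i * exp (-(a * u)) + r i * exp (b * u))
              * (-(a * p i) * exp (-(a * u)) + b * r i * exp (b * u)) ^ 2)
          / (1 + (κ + p i * exp (-(a * u)) + r i * exp (b * u)) ^ 2) ^ 2)) < 0 := by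
  rw [neg_neg_iff_pos]
  exact Finset.sum_pos' (fun i _ => div_nonneg (hc i) (by positivity))
    ⟨i₀, Finset.mem_univ _, div_pos hi₀ (by positivity)⟩

/-- **… so such a zero is a strict DOWNWARD crossing of `Θ'`** (`Θ'` has a negative derivative there).
[this file's theorem] -/
theorem phaseVelocity_deriv_neg_at_compatible_zero (a b κ u : ℝ) (p r : ι → ℝ)
    (h0 : ∑ i, (-(a * p i) * exp (-(a * u)) + b * r i * exp (b * u))
        / (1 + (κ + p i * exp (-(a * u)) + r i * exp (b * u)) ^ 2) = 0)
    (hc : ∀ i, 0 ≤ a * b * (-(p i * exp (-(a * u))) - r i * exp (b * u))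
              * (1 + (κ + p i * exp (-(a * u)) + r i * exp (b * u)) ^ 2)
            + 2 * (κ + p i * exp (-(a * u)) + r i * exp (b * u))
              * (-(a * p i) * exp (-(a * u)) + b * r i * exp (b * u)) ^ 2)
    (i₀ : ι) (hi₀ : 0 < a * b * (-(p i₀ * exp (-(a * u))) - r i₀ * exp (b * u))
              * (1 + (κ + p i₀ * exp (-(a * u)) + r i₀ * exp (b * u)) ^ 2)
            + 2 * (κ + p i₀ * exp (-(a * u)) + r i₀ * exp (b * u))
              * (-(a * p i₀) * exp (-(a * u)) + b * r i₀ * exp (b * u)) ^ 2) :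
    deriv (fun u => ∑ i, (-(a * p i) * exp (-(a * u)) + b * r i * exp (b * u))
        / (1 + (κ + p i * exp (-(a * u)) + r i * exp (b * u)) ^ 2)) u < 0 := by
  rw [(hasDerivAt_phaseVelocity_at_zero a b κ u p r h0).deriv]
  exact phaseAccel_neg_at_zero a b κ u p r hc i₀ hi₀

end Summit.ValiantsHypothesis.ValiantsHypothesis.Theorems.LacunarySymmetroidMatrixDescartes.ProductPlusOne.LensCloudCrossing
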